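import Mathlib

/-!
# T5SEArithmetic — the integer arithmetic of the archimedean S-E system (MEMO §10.4 (A)–(C); route/T5-CHECK-N43-p7.md §3, §4, §7)

Kernel annex of seat p7 (Tier-5 support for N4.3 / N5 of the cell pub-hodge-repro2). The Fock-model
weights of [KK07] Lemma 5.2(i) / Lemma 5.3(1)(i) enter as explicit integer expressions (weights are
DOUBLED so that everything lives in `ℤ`: a K-type `((m′+3)/2 + k, (m′−3)/2 − k)` is recorded as
`(m′ + 3 + 2k, m′ − 3 − 2k)`); nothing about representations, Fock spaces, Weil representations or
varieties is asserted — only that the weight EQUATIONS and INEQUALITIES the prose writes down have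
exactly the solutions it says.

* `tau1_match` — τ′₁ (compact place): `det^{(m′_A−1)/2} ⊗ Sym^k(std*) = det^{(m′₁−3)/2}` (one-dimensional)
  iff `k = 0 ∧ m′_A = m′₁ − 2` (CHECK-N43 §3; MEMO (A), σ₁ = +); the σ₁ = − variant.
* `tauj_lowest_match` — τ′_j (non-compact places): the lowest K_W-type of the β′-isotypic module
  `M_c` equals that of `π₀,τ′_j` iff `c = 2ε ∧ m′_A = m′_j + 2ε` with `ε = ±1` (CHECK-N43 §4;
  MEMO (A): «c = 2ε_j, m′_A(j) = m′_j + 2ε_j»).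
* `tauj_ktypes_eq` — with that solution the two K-type LADDERS coincide term by term.
* `halfline_interval`, `halfline_ends` — §7: both lines occur at τ′_j iff `m′_j − 2 ≤ m′_A ≤ m′_j + 2`,
  and the solution `m′_A = m′_j + 2ε` sits at an end with `(k, k′) = (1 − ε, 1 + ε)`.
* `beta_consistency_tau1`, `beta_consistency_tauj` — §7 / MEMO (C): `ξ′_{111} + ξ′_{100} = b`.
* `ktype_sets_disjoint`, `tau1_char_eq_inv_iff` — the contragredient exclusion (CHECK-N43 §3–§4):
  the K-type ladders of `π₀,τ′_j` and of its contragredient are disjoint for every `m′_j`; at τ′₁ the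
  characters `det^{±(m′₁−3)/2}` coincide only for `m′₁ = 3`.
* `D1_coeff_ne_zero` — §4 route (β): the coefficient `(k + max 0 (−c)) (k + max 0 c)` of `D₁ v_k` is
  non-zero for `k ≥ 1`.
-/

namespace Summit.Ventures.HodgeRepro2.T5SEArithmetic

/-- τ′₁, σ₁ = + (CHECK-N43 §3): in doubled weights, the K_W-type `det^{(m′_A−1)/2} ⊗ Sym^k(std₂*)`
(b_W-highest weight `(m′_A − 1, m′_A − 1 − 2k)`) equals the one-dimensional `det^{(m′₁−3)/2}`
(weight `(m′₁ − 3, m′₁ − 3)`) iff `k = 0` and `m′_A = m′₁ − 2`. -/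
theorem tau1_match (m'₁ m'A : ℤ) (k : ℕ) :
    (m'A - 1 = m'₁ - 3 ∧ m'A - 1 - 2 * (k : ℤ) = m'₁ - 3) ↔ (k = 0 ∧ m'A = m'₁ - 2) := by
  constructor
  · rintro ⟨h1, h2⟩
    refine ⟨?_, by omega⟩
    have : (k : ℤ) = 0 := by omega
    exact_mod_cast this
  · rintro ⟨rfl, rfl⟩
    constructor <;> omega

/-- τ′₁, σ₁ = − (CHECK-N43 §3, last parenthesis): `det^{(m′_A+1)/2} ⊗ Sym^k(std₂)` (weight
`(m′_A + 1 + 2k, m′_A + 1)`) equals `det^{(m′₁−3)/2}` iff `k = 0` and `m′_A = m′₁ − 4`. -/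
theorem tau1_match_neg (m'₁ m'A : ℤ) (k : ℕ) :
    (m'A + 1 + 2 * (k : ℤ) = m'₁ - 3 ∧ m'A + 1 = m'₁ - 3) ↔ (k = 0 ∧ m'A = m'₁ - 4) := by
  constructor
  · rintro ⟨h1, h2⟩
    refine ⟨?_, by omega⟩
    have : (k : ℤ) = 0 := by omega
    exact_mod_cast this
  · rintro ⟨rfl, rfl⟩
    constructor <;> omega

/-- The lowest K_W-type of `M_c` (doubled): `(m′_A + 1 + 2·max 0 (−c), m′_A − 1 − 2·max 0 c)`. -/
def lowestMc (m'A c : ℤ) : ℤ × ℤ := (m'A + 1 + 2 * max 0 (-c), m'A - 1 - 2 * max 0 c)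

/-- The lowest K_W-type of `π₀,τ′_j` (doubled): `(m′_j + 3, m′_j − 3)`. -/
def lowestPi0 (m'j : ℤ) : ℤ × ℤ := (m'j + 3, m'j - 3)

/-- τ′_j (CHECK-N43 §4; MEMO (A)): the lowest K_W-types of `M_c` and of `π₀,τ′_j` agree iff
`c = 2ε` and `m′_A = m′_j + 2ε` for a sign `ε = ±1` — «1 + |c| = 3». -/
theorem tauj_lowest_match (m'j m'A c : ℤ) :
    lowestMc m'A c = lowestPi0 m'j ↔
      (c = 2 ∧ m'A = m'j + 2) ∨ (c = -2 ∧ m'A = m'j - 2) := by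
  unfold lowestMc lowestPi0
  simp only [Prod.mk.injEq]
  constructor
  · rintro ⟨h1, h2⟩
    rcases le_or_gt 0 c with hc | hc
    · rw [max_eq_right hc, max_eq_left (by omega)] at *
      omega
    · rw [max_eq_left hc.le, max_eq_right (by omega)] at *
      omega
  · rintro (⟨rfl, rfl⟩ | ⟨rfl, rfl⟩) <;> simp <;> omega

/-- The `k`-th K_W-type of the ladder of `M_c` (doubled). -/
def ktypeMc (m'A c : ℤ) (k : ℕ) : ℤ × ℤ :=
  (m'A + 1 + 2 * max 0 (-c) + 2 * k, m'A - 1 - 2 * max 0 c - 2 * k)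

/-- The `k`-th K_W-type of the ladder of `π₀,τ′_j` (doubled): `(m′_j + 3 + 2k, m′_j − 3 − 2k)`. -/
def ktypePi0 (m'j : ℤ) (k : ℕ) : ℤ × ℤ := (m'j + 3 + 2 * k, m'j - 3 - 2 * k)

/-- With the solution of `tauj_lowest_match` the two ladders coincide term by term. -/
theorem tauj_ktypes_eq (m'j m'A c : ℤ)
    (h : (c = 2 ∧ m'A = m'j + 2) ∨ (c = -2 ∧ m'A = m'j - 2)) (k : ℕ) :
    ktypeMc m'A c k = ktypePi0 m'j k := by
  unfold ktypeMc ktypePi0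
  rcases h with ⟨rfl, rfl⟩ | ⟨rfl, rfl⟩ <;> simp <;> omega

/-- §7 (MEMO (C)), occurrence of the forced torus weights at τ′_j: the `+`-line needs
`(m′_j+3)/2 ≥ (m′_A+1)/2`, the `−`-line `(m′_j−3)/2 ≤ (m′_A−1)/2`; together (doubled) exactly
`m′_j − 2 ≤ m′_A ≤ m′_j + 2`. -/
theorem halfline_interval (m'j m'A : ℤ) :
    (m'j + 3 ≥ m'A + 1 ∧ m'j - 3 ≤ m'A - 1) ↔ (m'j - 2 ≤ m'A ∧ m'A ≤ m'j + 2) := by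
  omega

/-- §7: the S-E solution `m′_A = m′_j + 2ε` sits at an end of that interval, with
`k = (m′_j + 2 − m′_A)/2 = 1 − ε` on the `+`-line and `k′ = (m′_A − m′_j + 2)/2 = 1 + ε` on the
`−`-line, i.e. `(k, k′) = (0, 2)` for `ε = 1` and `(2, 0)` for `ε = −1`. -/
theorem halfline_ends (m'j : ℤ) (ε : ℤ) (hε : ε = 1 ∨ ε = -1) :
    (m'j - 2 ≤ m'j + 2 * ε ∧ m'j + 2 * ε ≤ m'j + 2) ∧
      (m'j + 2 - (m'j + 2 * ε)) / 2 = 1 - ε ∧ ((m'j + 2 * ε) - m'j + 2) / 2 = 1 + ε := by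
  rcases hε with rfl | rfl
  · refine ⟨⟨by omega, by omega⟩, ?_, ?_⟩ <;> omega
  · refine ⟨⟨by omega, by omega⟩, ?_, ?_⟩ <;> omega

/-- §7, τ′₁ (MEMO (C)): with `ξ′_i(1) = (m_{A,i}(1)+1)/2` (doubled: `m_{A,i} + 1`) and
`m_A = m_{A,111} + m_{A,100}`, the sum of the two line characters is `b₁ = m_A/2 + 1`
(doubled: `m_A + 2`). -/
theorem beta_consistency_tau1 (mA111 mA100 : ℤ) :
    (mA111 + 1) + (mA100 + 1) = (mA111 + mA100) + 2 := by
  ring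

/-- §7, τ′_j (MEMO (C)): with `ξ′_{111}(j) = (m_{A,111} + m′_A)/2 − (m′_j+3)/2`,
`ξ′_{100}(j) = (m_{A,100} + m′_A)/2 − (m′_j−3)/2` (doubled) and `m′_A = m′_j + 2ε`, the sum is
`b_j = m_A/2 + 2ε` (doubled: `m_A + 4ε`). -/
theorem beta_consistency_tauj (mA111 mA100 m'j ε : ℤ) :
    ((mA111 + (m'j + 2 * ε)) - (m'j + 3)) + ((mA100 + (m'j + 2 * ε)) - (m'j - 3)) =
      (mA111 + mA100) + 4 * ε := by
  ring

/-- Contragredient exclusion at τ′_j (CHECK-N43 §4): the K-type ladder of `π₀,τ′_j`,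
`(m′_j + 3 + 2k, m′_j − 3 − 2k)`, and that of its contragredient, `(−(m′_j + 3) − 2k′, −(m′_j − 3) + 2k′)`,
are disjoint for EVERY `m′_j` (adding the two coordinate equations forces `6 + 2k + 2k′ = 0`). -/
theorem ktype_sets_disjoint (m'j : ℤ) (k k' : ℕ) :
    ktypePi0 m'j k ≠ (-(m'j + 3) - 2 * k', -(m'j - 3) + 2 * k') := by
  unfold ktypePi0
  intro h
  simp only [Prod.mk.injEq] at h
  omega

/-- Contragredient exclusion at τ′₁ (CHECK-N43 §3): `det^{(m′₁−3)/2} = det^{−(m′₁−3)/2}` as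
characters (equal exponents) iff `m′₁ = 3`. -/
theorem tau1_char_eq_inv_iff (m'₁ : ℤ) : (m'₁ - 3 = -(m'₁ - 3)) ↔ m'₁ = 3 := by
  omega

/-- §4 route (β): `D₁ v_k = (k + max 0 (−c)) (k + max 0 c) · v_{k−1}` has a non-zero coefficient for
`k ≥ 1`. -/
theorem D1_coeff_ne_zero (c : ℤ) (k : ℕ) (hk : 1 ≤ k) :
    ((k : ℤ) + max 0 (-c)) * ((k : ℤ) + max 0 c) ≠ 0 := by
  apply mul_ne_zero
  · have : (0 : ℤ) ≤ max 0 (-c) := le_max_left _ _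
    omega
  · have : (0 : ℤ) ≤ max 0 c := le_max_left _ _
    omega

/-- §2 (B) at τ′_j: `D(Q^k) = k(k+2)·Q^{k−1}` — the coefficient `k(k+2)` is non-zero for `k ≥ 1`. -/
theorem DQ_coeff_ne_zero (k : ℕ) (hk : 1 ≤ k) : (k : ℤ) * ((k : ℤ) + 2) ≠ 0 := by
  apply mul_ne_zero <;> omega

end Summit.Ventures.HodgeRepro2.T5SEArithmetic
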